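import Summits.HodgeConjecture.HodgeConjecture.Theorems.MarkmanPartnerTransportK3Sq2TypeHodgeOfCycleInducedGenerator
import Summits.HodgeConjecture.HodgeConjecture.Theorems.MarkmanPartnerTransportPicardThreeK3SquaresAlgebraicLocusSpread
import Literature.AlgebraicGeometry.HodgeTheory.BlochSemiregularSpread
import Literature.AlgebraicGeometry.HodgeTheory.AlgebraicClassesPullback
import HarnessLib
import Summits.HodgeConjecture.HodgeConjecture.Theorems.MarkmanPartnerTransportCycleInducedOfKappaClass
import Summits.HodgeConjecture.HodgeConjecture.Theorems.MarkmanPartnerTransportKappaClassHodge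

/-!
# Orphan levers, T3 «ORPH-SR»: HC⁴ for `K3^{[2]}`-type fourfolds with `End_Hdg(T) = ℚ + ℚθ` from a semiregular seed

Sub-problem `HodgeConjecture`, route MarkmanPartnerTransport, rung «ORPHAN-RM» (memo ROUTE-P1AJ §C, target T3 of
`Sketch_P1AJ_OrphanSR_g37` r3, cell hodge-nonav). For a marked smooth projective `K3^{[2]}`-type fourfold
`(X, φ, P, z)` whose rational Hodge endomorphisms of `H²` killing `N¹(X)` with `q`-transcendental image are
`a + c·θ` on `T(X)` for ONE rational type-preserving `θ` (`E(X) = ℚ(θ)` real quadratic; ANY Picard rank,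
partnered OR orphan), the Hodge conjecture holds in degree `4`, GRANTED a SEMIREGULAR SEED for the kappa class
`κ_θ = Σ_{ij} (G⁻¹)_{ij} φ⁻¹eᵢ ∪ θ(φ⁻¹eⱼ)`: `X ≅ 𝒳_{t₁}` is a fibre of a smooth projective family `f : 𝒳 → B`
(quasi-projective total space, smooth quasi-projective base, `B(ℂ)` connected) carrying a global class
`W ∈ H⁴(𝒳(ℂ); ℂ)` fibrewise rational of type `(2,2)` with `W|_X ≡ κ_θ (mod A²(X))`, and at some point `s₀` the
fibre value `W|_{𝒳_{s₀}}` is supported on an integral Bloch-semiregular local complete intersection surface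
`Z ⊂ X₀ ≅ 𝒳_{s₀}`. NO Kuga–Satake hypothesis; modulo the named facts {Bloch 1972 / Buchweitz–Flenner 2003
Thm 5.2 (`BlochSemiregularSpread 4 2`), Verbitsky–Guan, O'Grady 2008}; Charles–Schnell's algebraicity-locus
theorem (`AlgebraicLocusSpread.algebraicLocusClosed`) and Voisin's cup-product lemma are tree THEOREMS.

Chain. (T3A) Bloch spread near `s₀` → Baire spread to all of `B(ℂ)` (`algebraicLocusClosed`) → transport
along `e₁` (`map_mem_algebraicClasses_of_isIso`) → `κ_θ ∈ A²(X)`. (T3B) `κ_θ` is a graph class for `θ`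
(`exists_graphClass_of_kappaClass`), `0` is a graph class for `id` (`t = −2`), so `SpannedByGraph` holds with
generators `{id, θ}` → `hodgeConjectureFor_of_spannedByGraphClasses`. (T3) = (T3B) ∘ (T3A).

CONDITIONAL on the EXISTENCE of the seed package (an open input: no printed example of a semiregular
non-Lagrangian surface detecting a real-multiplication class on a hyperkähler fourfold) and on the three named
facts; credits nothing to the Hodge conjecture; the «ORPHAN-RM» cell stays open unconditionally.

References: S. Bloch, Invent. Math. 17 (1972) Thm. 7.3; R.-O. Buchweitz, H. Flenner, Compositio Math. 137
(2003) Thm. 5.2; F. Charles, C. Schnell, arXiv:1010.4422 Thm. 1; C. Voisin, *Hodge Theory II*, Lemma 5.13,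
Lemma 11.41; K. O'Grady, *Pure Appl. Math. Q.* 4 (2008).
-/

noncomputable section

set_option linter.dupNamespace false

open Module CategoryTheory MonoidalCategory AlgebraicGeometry
open Literature.AlgebraicTopology.SingularHomology Literature.Geometry.Kaehler
open Literature.AlgebraicGeometry Literature.AlgebraicGeometry.Motives Literature.AlgebraicGeometry.HodgeTheory
open Literature.AlgebraicGeometry.Hyperkaehler Literature.AlgebraicGeometry.Surfaces
open Summit.HodgeConjecture.HodgeConjecture.Theorems.NikulinTwinTransport
open Summit.HodgeConjecture.HodgeConjecture.Theorems.MarkmanPartnerTransport.BBFPositivity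
open Summit.HodgeConjecture.HodgeConjecture.Theorems.MarkmanPartnerTransport.PartnerLattice
open Summit.HodgeConjecture.HodgeConjecture.Theorems.MarkmanPartnerTransport.AlgebraicLocusSpread

namespace Summit.HodgeConjecture.HodgeConjecture.Theorems.MarkmanPartnerTransport.OrphanSR

/-- `MarkedK3Sq[X, φ, P, z]`: VERBATIM the `let MarkedK3Sq := …` binder of the route declarations of
MarkmanPartnerTransport (clauses (m1)–(m6)). Local notation only. -/
local notation3 (prettyPrint := false) "MarkedK3Sq[" X ", " φ ", " P ", " z "]" =>
  (((IsIntegralClass P ∧ ∀ Q : complexBetti X (2 * 4), IsIntegralClass Q → ∃ n : ℤ, Q = n • P) ∧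
    (∀ c : complexBetti X 2, IsIntegralClass c ↔ ∃ v : K3HilbertIndex → ℤ, φ c = fun i => (v i : ℂ)) ∧
    (∀ a : complexBetti X 2, cupPowTwo a 4 = ((3 : ℂ) * (k3HilbertForm 2 (φ a) (φ a)) ^ 2) • P) ∧
    (IsOfHodgeType 4 X 2 2 0 (LinearEquiv.symm φ z) ∧
      ∀ τ : complexBetti X 2, IsOfHodgeType 4 X 2 2 0 τ → ∃ t : ℂ, τ = t • LinearEquiv.symm φ z) ∧
    (∀ c : complexBetti X 2, IsOfHodgeType 4 X 2 1 1 c ↔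
      (k3HilbertForm 2 (φ c) z = 0 ∧ k3HilbertForm 2 (φ c) (star z) = 0)) ∧
    (k3HilbertForm 2 z z = 0 ∧ 0 < (k3HilbertForm 2 (star z) z).re)))

/-- `Cup3[c, y, w] = (c ∪ y) ∪ w ∈ H⁸` for `c ∈ H⁴`, `y, w ∈ H²`. Local notation only. -/
local notation3 (prettyPrint := false) "Cup3[" c ", " y ", " w "]" =>
  cupProduct (rfl : 2 * 3 + 2 = 2 * 4) (cupProduct (rfl : 2 * 2 + 2 = 2 * 3) c y) w

/-- `Kap[φ, g] = Σ_{ij} (G⁻¹)_{ij} · φ⁻¹eᵢ ∪ g(φ⁻¹eⱼ) ∈ H⁴(X(ℂ); ℂ)`, the kappa class of an endomorphism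
`g` of `H²(X(ℂ); ℂ)` (VERBATIM `…K3Sq2TypeHodgeGraphClassesGeneral`). Local notation only. -/
local notation3 (prettyPrint := false) "Kap[" φ ", " g "]" =>
  (∑ i : K3HilbertIndex, ∑ j : K3HilbertIndex,
    (((k3HilbertGram 2).map (Int.cast : ℤ → ℂ))⁻¹ i j) •
      cupProduct (rfl : 2 + 2 = 2 * 2) ((LinearEquiv.symm φ) (Pi.single i 1))
        (g ((LinearEquiv.symm φ) (Pi.single j 1))))

/-- `Res[f, s, k, A] = A|_{𝒳_s}`, restriction of a global class to the fibre over `s`. Local notation only. -/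
local notation3 (prettyPrint := false) "Res[" f ", " s ", " k ", " A "]" =>
  complexBetti.map (Motives.fiberι f s) k A

variable {X : SchemeOver ℂ} {φ : complexBetti X 2 ≃ₗ[ℂ] (K3HilbertIndex → ℂ)} {P : complexBetti X (2 * 4)}
  {z : K3HilbertIndex → ℂ}

/-! ### (T3, step B) HC⁴ from an algebraic kappa class of the quadratic generator — fact-free beyond the engine -/

/-- **(T3B)** For a marked smooth projective `K3^{[2]}`-type `X` and a rational type-preserving `θ` with
`End_Hdg`-generation `f|_T = a + c·θ`, if `κ_θ ∈ A²(X)` then HC⁴(X): `κ_θ` is a graph class for `θ`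
(`exists_graphClass_of_kappaClass`), `0` is a graph class for `id` (`t = −2`, `q` symmetric), so
`SpannedByGraph` holds with generators `{id, θ}`; modulo {Verbitsky–Guan, O'Grady}. -/
theorem hodgeConjectureFor_of_kappaClass_generator
    (hV : VerbitskyGuan_cohomology_K3HilbertSquareType) (hO : OGrady2008_dualBBFClass_algebraic)
    (hX : IsSmoothProjective 4 X) (hK : IsOfK3HilbertSquareType X) (hM : MarkedK3Sq[X, φ, P, z])
    (θ : complexBetti X 2 →ₗ[ℂ] complexBetti X 2)
    (h1 : ∀ y, IsRationalClass y → IsRationalClass (θ y))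
    (h2 : ∀ (i j : ℕ) y, IsOfHodgeType 4 X 2 i j y → IsOfHodgeType 4 X 2 i j (θ y))
    (hgen : ∀ f : complexBetti X 2 →ₗ[ℂ] complexBetti X 2, (∀ y, IsRationalClass y → IsRationalClass (f y)) →
      (∀ (i j : ℕ) y, IsOfHodgeType 4 X 2 i j y → IsOfHodgeType 4 X 2 i j (f y)) →
      (∀ e : complexBetti X 2, e ∈ algebraicClasses X 1 → f e = 0) →
      (∀ y : complexBetti X 2, ∀ e : complexBetti X 2, e ∈ algebraicClasses X 1 →
        k3HilbertForm 2 (φ (f y)) (φ e) = 0) →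
      ∃ a c : ℚ, ∀ y : complexBetti X 2,
        (∀ e : complexBetti X 2, e ∈ algebraicClasses X 1 → k3HilbertForm 2 (φ y) (φ e) = 0) →
        f y = (a : ℂ) • y + (c : ℂ) • θ y)
    (hκ : Kap[φ, θ] ∈ algebraicClasses X 2) :
    HodgeConjectureFor 4 X := by
  obtain ⟨cg, hcg, t, hcub⟩ := exists_graphClass_of_kappaClass hM θ hκ
  refine hodgeConjectureFor_of_spannedByGraphClasses hV hO
    Summit.HodgeConjecture.HodgeConjecture.Theorems.Voisin2003_cupProduct_algebraicClasses_holds hX hK hM ?_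
  intro f hfrat hfh hfN hfT
  obtain ⟨a, c, hac⟩ := hgen f hfrat hfh hfN hfT
  refine ⟨2, ![a, c], ![LinearMap.id, θ], ?_, ?_⟩
  · intro i
    match i with
    | 0 =>
      simp only [Matrix.cons_val_zero]
      refine ⟨fun y hy => by simpa using hy, fun a b y hy => by simpa using hy, 0, zero_mem _, -2, ?_⟩
      intro y w
      simp only [map_zero, LinearMap.zero_apply, LinearMap.id_apply]
      rw [k3HilbertForm_comm 2 (φ w) (φ y)]
      ring_nf
      simp
    | 1 =>
      simp only [Matrix.cons_val_one]
      exact ⟨h1, h2, cg, hcg, t, hcub⟩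
  · intro y hy
    rw [hac y hy, Fin.sum_univ_two]
    simp

/-! ### (T3, step A) the kappa class is algebraic from a semiregular seed somewhere in a connected family -/

/-- **(T3A)** Bloch spread near the seed fibre (`BlochSemiregularSpread 4 2`), Baire spread to the
whole connected base (`algebraicLocusClosed`, Charles–Schnell), transport along `e₁ : X ≅ 𝒳_{t₁}`
(`map_mem_algebraicClasses_of_isIso`); the fibre value at `t₁` need only agree with `κ_θ` MODULO ALGEBRAIC classes
(twists by `h²`, `q^∨`, divisor products are free). Modulo {Bloch/BF semiregularity theorem}. -/
theorem kappaClass_mem_algebraicClasses_of_semiregularSeed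
    (hBl : BlochSemiregularSpread 4 2)
    (θ : complexBetti X 2 →ₗ[ℂ] complexBetti X 2)
    (X₀ : SchemeOver ℂ) (Z : Scheme.{0}) (i : Z ⟶ X₀.left) (x : complexBetti X₀ (2 * 2))
    (𝒳 B : SchemeOver ℂ) (f : 𝒳 ⟶ B) (s₀ t₁ : ComplexPoints B) (e₀ : X₀ ≅ fiberOver f s₀)
    (e₁ : X ≅ fiberOver f t₁) (W : complexBetti 𝒳 (2 * 2))
    (hi : IsClosedImmersion i) (hreg : IsRegularImmersionOfCodim i 2) (hZ : AlgebraicGeometry.IsIntegral Z)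
    (hcoh : ∀ z ∈ Set.range i.base, (2 : ℕ∞) ≤ Order.coheight z)
    (hsr : IsBlochSemiregular i 4 2)
    (hx : x ∈ classesSupportedOn X₀ (Set.range i.base) (2 * 2))
    (hf : IsSmoothProjectiveFamily f 4) (h𝒳 : IsQuasiProjectiveOver 𝒳) (hB : IsQuasiProjectiveOver B)
    (hBsm : AlgebraicGeometry.Smooth B.hom) (hconn : ConnectedSpace (ComplexPoints B))
    (hW : ∀ s : ComplexPoints B, IsRationalClass (Res[f, s, 2 * 2, W]) ∧
      IsOfHodgeType 4 (fiberOver f s) (2 * 2) 2 2 (Res[f, s, 2 * 2, W]))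
    (hWx : complexBetti.map e₀.hom (2 * 2) (Res[f, s₀, 2 * 2, W]) = x)
    (hWθ : complexBetti.map e₁.hom (2 * 2) (Res[f, t₁, 2 * 2, W]) - Kap[φ, θ] ∈ algebraicClasses X 2) :
    Kap[φ, θ] ∈ algebraicClasses X 2 := by
  obtain ⟨U, hU, hs₀, hUalg⟩ :=
    hBl X₀ Z i x 𝒳 B f s₀ e₀ W hi hreg hZ hcoh hsr hx hf h𝒳 hB hBsm hW hWx
  have halg := algebraicLocusClosed 𝒳 B f 4 2 W hf h𝒳 hB hBsm hconn U hU ⟨s₀, hs₀⟩ hUalg t₁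
  have hX' := map_mem_algebraicClasses_of_isIso e₁.hom halg
  have := sub_mem hX' hWθ
  rwa [sub_sub_cancel] at this

/-! ### (T3) ORPH-SR — the composition -/

/-- **(T3) target `ORPH-SR`.** HC⁴(X) for a marked smooth projective `K3^{[2]}`-type fourfold with
`End_Hdg`-generation by one rational type-preserving `θ` (`E(X) = ℚ(θ)`; any `ρ`, partnered or orphan),
GRANTED a semiregular seed for `κ_θ` in a connected smooth projective family through `X`; modulo
{Bloch1972/BuchweitzFlenner2003 Thm 5.2, Verbitsky–Guan, O'Grady2008}; NO Kuga–Satake hypothesis. -/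
theorem hodgeConjectureFor_of_quadraticEndomorphismField_of_semiregularSeed
    (hV : VerbitskyGuan_cohomology_K3HilbertSquareType) (hO : OGrady2008_dualBBFClass_algebraic)
    (hBl : BlochSemiregularSpread 4 2)
    (hX : IsSmoothProjective 4 X) (hK : IsOfK3HilbertSquareType X) (hM : MarkedK3Sq[X, φ, P, z])
    (θ : complexBetti X 2 →ₗ[ℂ] complexBetti X 2)
    (h1 : ∀ y, IsRationalClass y → IsRationalClass (θ y))
    (h2 : ∀ (i j : ℕ) y, IsOfHodgeType 4 X 2 i j y → IsOfHodgeType 4 X 2 i j (θ y))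
    (hgen : ∀ f : complexBetti X 2 →ₗ[ℂ] complexBetti X 2, (∀ y, IsRationalClass y → IsRationalClass (f y)) →
      (∀ (i j : ℕ) y, IsOfHodgeType 4 X 2 i j y → IsOfHodgeType 4 X 2 i j (f y)) →
      (∀ e : complexBetti X 2, e ∈ algebraicClasses X 1 → f e = 0) →
      (∀ y : complexBetti X 2, ∀ e : complexBetti X 2, e ∈ algebraicClasses X 1 →
        k3HilbertForm 2 (φ (f y)) (φ e) = 0) →
      ∃ a c : ℚ, ∀ y : complexBetti X 2,
        (∀ e : complexBetti X 2, e ∈ algebraicClasses X 1 → k3HilbertForm 2 (φ y) (φ e) = 0) →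
        f y = (a : ℂ) • y + (c : ℂ) • θ y)
    (X₀ : SchemeOver ℂ) (Z : Scheme.{0}) (i : Z ⟶ X₀.left) (x : complexBetti X₀ (2 * 2))
    (𝒳 B : SchemeOver ℂ) (f : 𝒳 ⟶ B) (s₀ t₁ : ComplexPoints B) (e₀ : X₀ ≅ fiberOver f s₀)
    (e₁ : X ≅ fiberOver f t₁) (W : complexBetti 𝒳 (2 * 2))
    (hi : IsClosedImmersion i) (hreg : IsRegularImmersionOfCodim i 2) (hZ : AlgebraicGeometry.IsIntegral Z)
    (hcoh : ∀ z ∈ Set.range i.base, (2 : ℕ∞) ≤ Order.coheight z)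
    (hsr : IsBlochSemiregular i 4 2)
    (hx : x ∈ classesSupportedOn X₀ (Set.range i.base) (2 * 2))
    (hf : IsSmoothProjectiveFamily f 4) (h𝒳 : IsQuasiProjectiveOver 𝒳) (hB : IsQuasiProjectiveOver B)
    (hBsm : AlgebraicGeometry.Smooth B.hom) (hconn : ConnectedSpace (ComplexPoints B))
    (hW : ∀ s : ComplexPoints B, IsRationalClass (Res[f, s, 2 * 2, W]) ∧
      IsOfHodgeType 4 (fiberOver f s) (2 * 2) 2 2 (Res[f, s, 2 * 2, W]))
    (hWx : complexBetti.map e₀.hom (2 * 2) (Res[f, s₀, 2 * 2, W]) = x)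
    (hWθ : complexBetti.map e₁.hom (2 * 2) (Res[f, t₁, 2 * 2, W]) - Kap[φ, θ] ∈ algebraicClasses X 2) :
    HodgeConjectureFor 4 X :=
  hodgeConjectureFor_of_kappaClass_generator hV hO hX hK hM θ h1 h2 hgen
    (kappaClass_mem_algebraicClasses_of_semiregularSeed hBl θ X₀ Z i x 𝒳 B f s₀ t₁ e₀ e₁ W hi hreg hZ hcoh
      hsr hx hf h𝒳 hB hBsm hconn hW hWx hWθ)

/-! ### (T3′) ORPH-SR-ANY — the seed road for `E(X) = ℚ(θ)` of ANY degree (appended, gen 13) -/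

/-- **(T3′) target `ORPH-SR-ANY`: the seed road for `E(X) = ℚ(θ)` of ANY degree** (covers the cell
«[E:ℚ] ≥ 3, not multiquadratic», which has no lever even modulo Kuga–Satake): HC⁴(X) for a marked smooth
projective `K3^{[2]}`-type `X` carrying a rational, type-preserving, `q`-self-adjoint `θ` such that every
rational Hodge endomorphism killing `N¹(X)` with transcendental image is a rational POLYNOMIAL in `θ` on
`T(X)`, GRANTED one semiregular seed for `κ_θ` (as in T3A): T3A (`κ_θ ∈ A²(X)`) + T3C
(`exists_corrAction_eq_of_kappaClass`: `θ` is cycle-induced) + the tree's F4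
`hodgeConjectureFor_of_cycleInducedGenerator_of_charlesMarkman`; modulo {Bloch 1972 / Buchweitz–Flenner 2003
Thm. 5.2, Verbitsky–Guan, O'Grady 2008, Charles–Markman 2013}; CONDITIONAL on the seed-package existence.
[cite: BuchweitzFlenner2003, Thm. 5.2] [cite: CharlesMarkman2013, Thm. 1.1 (§1)] [cite: Markman2024, §1.1 Thm. 1.1] -/
theorem hodgeConjectureFor_of_endomorphismField_of_semiregularSeed
    (hV : VerbitskyGuan_cohomology_K3HilbertSquareType) (hO : OGrady2008_dualBBFClass_algebraic)
    (hB : CharlesMarkman2013_lefschetzStandard_K3HilbertType) (hBl : BlochSemiregularSpread 4 2)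
    (hX : IsSmoothProjective 4 X) (hK : IsOfK3HilbertSquareType X) (hM : MarkedK3Sq[X, φ, P, z])
    (θ : complexBetti X 2 →ₗ[ℂ] complexBetti X 2)
    (h1 : ∀ y, IsRationalClass y → IsRationalClass (θ y))
    (h2 : ∀ (i j : ℕ) y, IsOfHodgeType 4 X 2 i j y → IsOfHodgeType 4 X 2 i j (θ y))
    (h5 : ∀ y w : complexBetti X 2, k3HilbertForm 2 (φ (θ y)) (φ w) = k3HilbertForm 2 (φ y) (φ (θ w)))
    (hgen : ∀ f : complexBetti X 2 →ₗ[ℂ] complexBetti X 2, (∀ y, IsRationalClass y → IsRationalClass (f y)) →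
      (∀ (i j : ℕ) y, IsOfHodgeType 4 X 2 i j y → IsOfHodgeType 4 X 2 i j (f y)) →
      (∀ d : complexBetti X 2, d ∈ algebraicClasses X 1 → f d = 0) →
      (∀ y : complexBetti X 2, ∀ d : complexBetti X 2, d ∈ algebraicClasses X 1 →
        k3HilbertForm 2 (φ (f y)) (φ d) = 0) →
      ∃ (n : ℕ) (a : Fin n → ℚ), ∀ y : complexBetti X 2,
        (∀ d : complexBetti X 2, d ∈ algebraicClasses X 1 → k3HilbertForm 2 (φ y) (φ d) = 0) →
        f y = ∑ i : Fin n, ((a i : ℂ) • (θ ^ (i : ℕ)) y))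
    (X₀ : SchemeOver ℂ) (Z : Scheme.{0}) (i : Z ⟶ X₀.left) (x : complexBetti X₀ (2 * 2))
    (𝒳 B : SchemeOver ℂ) (f : 𝒳 ⟶ B) (s₀ t₁ : ComplexPoints B) (e₀ : X₀ ≅ fiberOver f s₀)
    (e₁ : X ≅ fiberOver f t₁) (W : complexBetti 𝒳 (2 * 2))
    (hi : IsClosedImmersion i) (hreg : IsRegularImmersionOfCodim i 2) (hZ : AlgebraicGeometry.IsIntegral Z)
    (hcoh : ∀ z ∈ Set.range i.base, (2 : ℕ∞) ≤ Order.coheight z)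
    (hsr : IsBlochSemiregular i 4 2)
    (hx : x ∈ classesSupportedOn X₀ (Set.range i.base) (2 * 2))
    (hf : IsSmoothProjectiveFamily f 4) (h𝒳 : IsQuasiProjectiveOver 𝒳) (hBq : IsQuasiProjectiveOver B)
    (hBsm : AlgebraicGeometry.Smooth B.hom) (hconn : ConnectedSpace (ComplexPoints B))
    (hW : ∀ s : ComplexPoints B, IsRationalClass (Res[f, s, 2 * 2, W]) ∧
      IsOfHodgeType 4 (fiberOver f s) (2 * 2) 2 2 (Res[f, s, 2 * 2, W]))
    (hWx : complexBetti.map e₀.hom (2 * 2) (Res[f, s₀, 2 * 2, W]) = x)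
    (hWθ : complexBetti.map e₁.hom (2 * 2) (Res[f, t₁, 2 * 2, W]) - Kap[φ, θ] ∈ algebraicClasses X 2) :
    HodgeConjectureFor 4 X :=
  hodgeConjectureFor_of_cycleInducedGenerator_of_charlesMarkman hV hO hB hX hK hM θ h1 h2
    (exists_corrAction_eq_of_kappaClass hV hB hX hK hM θ h5
      (kappaClass_mem_algebraicClasses_of_semiregularSeed hBl θ X₀ Z i x 𝒳 B f s₀ t₁ e₀ e₁ W hi hreg hZ hcoh
        hsr hx hf h𝒳 hBq hBsm hconn hW hWx hWθ))
    hgen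

/-! ### «CYCLE-CLASS SOCKET» (appended, gen 13): the endpoint a geometric seed class feeds -/

/-- **(b1) Products of rational `(1,1)`-classes are algebraic**: for `X` smooth projective of dimension `4`
and `x, y ∈ H²(X(ℂ); ℂ)` rational of Hodge type `(1,1)`, `x ∪ y ∈ A²(X)` — Lefschetz' theorem on
`(1,1)`-classes (`lefschetzOneOne_rational_holds`) and the multiplicativity of algebraic classes
(`Voisin2003_cupProduct_algebraicClasses_holds'`), both tree theorems. (The «NS∕δ-sector» of memo ROUTE-P1AJ
§C.5–§C.6.) [cite: VoisinHodgeI2002, Thm. 11.30] [cite: VoisinHodgeII2003, §9.2.4 Prop. 9.20] -/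
theorem cup_ratOneOne_mem_algebraicClasses_two (hX : IsSmoothProjective 4 X) {x y : complexBetti X 2}
    (hx : IsRationalClass x) (hx11 : IsOfHodgeType 4 X 2 1 1 x) (hy : IsRationalClass y)
    (hy11 : IsOfHodgeType 4 X 2 1 1 y) :
    cupProduct (rfl : 2 + 2 = 2 * 2) x y ∈ algebraicClasses X 2 := by
  have h := Voisin2003_cupProduct_algebraicClasses_holds' hX (lefschetzOneOne_rational_holds hX _ hx hx11)
    (lefschetzOneOne_rational_holds hX _ hy hy11)
  exact h

/-- **(b2) The kappa class is algebraic as soon as ONE algebraic codimension-`2` class has a non-zero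
`κ_θ`-coefficient modulo `⟨q^∨⟩ +` an algebraic remainder**: if `W = a·q^∨ + c·κ_θ + D` with `W, D ∈ A²(X)`,
`c ≠ 0`, then `κ_θ ∈ A²(X)` (O'Grady: `q^∨ ∈ A²(X)`; submodule arithmetic). Geometric source intended (memo
ROUTE-P1AJ §C.5–§C.6, «SR-AUT»): a deformed symmetrised graph surface `Z_t ⊂ S_t^{[2]}` with
`[Z_t] = ¾ q^∨ + (5/4) κ_{pr NS} + ¼ κ_θ + δ`-sector, `D` = the NS∕δ-sector via (b1). Modulo {O'Grady 2008}.
[cite: OGrady2008NumericalK3Square, §3 Claim 3.1 and proof of Prop. 3.2 (6)] -/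
theorem kappaClass_mem_algebraicClasses_of_decomposition (hO : OGrady2008_dualBBFClass_algebraic)
    (hX : IsSmoothProjective 4 X) (hK : IsOfK3HilbertSquareType X) (hM : MarkedK3Sq[X, φ, P, z])
    (θ : complexBetti X 2 →ₗ[ℂ] complexBetti X 2) {W D : complexBetti X (2 * 2)}
    (hW : W ∈ algebraicClasses X 2) (hD : D ∈ algebraicClasses X 2) {a c : ℂ} (hc : c ≠ 0)
    (h : W = a • dualBBFClass 2 φ + c • Kap[φ, θ] + D) :
    Kap[φ, θ] ∈ algebraicClasses X 2 := by
  have hq : dualBBFClass 2 φ ∈ algebraicClasses X 2 := (hO X hX hK φ P (isMarkedK3Hilb_of_marked hM)).1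
  have hcK : c • Kap[φ, θ] = W - a • dualBBFClass 2 φ - D := by rw [h]; abel
  have hK' : Kap[φ, θ] = c⁻¹ • (W - a • dualBBFClass 2 φ - D) := by
    rw [← hcK, smul_smul, inv_mul_cancel₀ hc, one_smul]
  rw [hK']
  exact Submodule.smul_mem _ _ (Submodule.sub_mem _ (Submodule.sub_mem _ hW (Submodule.smul_mem _ _ hq)) hD)

/-- **(b3) HC⁴ from ONE algebraic codimension-`2` class with non-zero `κ_θ`-coefficient modulo `⟨q^∨⟩ +` an
algebraic remainder**, for a marked smooth projective `K3^{[2]}`-type `X` with `End_Hdg`-generation `a + cθ` on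
`T(X)` (`E(X) = ℚ(θ)` real quadratic, supplied as the explicit binder `hgen` — at `ρ(X) = 3`, `dim T = 20 = 4·5`
the one-cycle arithmetic of `…K3Sq2OneCycleFifth` does not exclude a quartic `E`): (b2) then T3B
(`hodgeConjectureFor_of_kappaClass_generator`). Modulo {Verbitsky–Guan, O'Grady 2008}.
[cite: OGrady2008NumericalK3Square, §3 Claim 3.1] [cite: Markman2024, §1.1 Thm. 1.1] -/
theorem hodgeConjectureFor_of_algebraicClass_mod_neronSeveriSector
    (hV : VerbitskyGuan_cohomology_K3HilbertSquareType) (hO : OGrady2008_dualBBFClass_algebraic)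
    (hX : IsSmoothProjective 4 X) (hK : IsOfK3HilbertSquareType X) (hM : MarkedK3Sq[X, φ, P, z])
    (θ : complexBetti X 2 →ₗ[ℂ] complexBetti X 2)
    (h1 : ∀ y, IsRationalClass y → IsRationalClass (θ y))
    (h2 : ∀ (i j : ℕ) y, IsOfHodgeType 4 X 2 i j y → IsOfHodgeType 4 X 2 i j (θ y))
    (hgen : ∀ f : complexBetti X 2 →ₗ[ℂ] complexBetti X 2, (∀ y, IsRationalClass y → IsRationalClass (f y)) →
      (∀ (i j : ℕ) y, IsOfHodgeType 4 X 2 i j y → IsOfHodgeType 4 X 2 i j (f y)) →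
      (∀ e : complexBetti X 2, e ∈ algebraicClasses X 1 → f e = 0) →
      (∀ y : complexBetti X 2, ∀ e : complexBetti X 2, e ∈ algebraicClasses X 1 →
        k3HilbertForm 2 (φ (f y)) (φ e) = 0) →
      ∃ a c : ℚ, ∀ y : complexBetti X 2,
        (∀ e : complexBetti X 2, e ∈ algebraicClasses X 1 → k3HilbertForm 2 (φ y) (φ e) = 0) →
        f y = (a : ℂ) • y + (c : ℂ) • θ y)
    {W D : complexBetti X (2 * 2)} (hW : W ∈ algebraicClasses X 2) (hD : D ∈ algebraicClasses X 2)
    {a c : ℂ} (hc : c ≠ 0) (h : W = a • dualBBFClass 2 φ + c • Kap[φ, θ] + D) :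
    HodgeConjectureFor 4 X :=
  hodgeConjectureFor_of_kappaClass_generator hV hO hX hK hM θ h1 h2 hgen
    (kappaClass_mem_algebraicClasses_of_decomposition hO hX hK hM θ hW hD hc h)

/-! ### «KAPPA-IFF» (appended, gen 13): HC⁴(X) is EXACTLY the algebraicity of `κ_θ` -/

/-- **(KAPPA-IFF) For `E(X) = ℚ(θ)` real quadratic, the Hodge conjecture for `X` is equivalent to the algebraicity
of the single explicit class `κ_θ`.** For a marked smooth projective `K3^{[2]}`-type fourfold `(X, φ, P, z)` with a
rational, type-preserving `θ` such that every rational Hodge endomorphism of `H²` killing `N¹(X)` with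
`q`-transcendental image is `a + c·θ` on `T(X)`: `HodgeConjectureFor 4 X ↔ κ_θ ∈ A²(X)`. (⇐) is T3B
(`hodgeConjectureFor_of_kappaClass_generator`); (⇒) because `κ_θ` is a RATIONAL class of HODGE TYPE `(2,2)`
(`isRationalClass_kappaClass`, `isOfHodgeType_kappaClass`, tree theorems of `…KappaClassHodge`). Modulo
{Verbitsky–Guan, O'Grady 2008} (used by (⇐) only). [cite: OGrady2008NumericalK3Square, §2.2 and §3]
[cite: Markman2024, §1.1 Thm. 1.1] [cite: VoisinHodgeI2002, §7.1.1 and §11.1] -/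
theorem hodgeConjectureFor_iff_kappaClass_mem_algebraicClasses
    (hV : VerbitskyGuan_cohomology_K3HilbertSquareType) (hO : OGrady2008_dualBBFClass_algebraic)
    (hX : IsSmoothProjective 4 X) (hK : IsOfK3HilbertSquareType X) (hM : MarkedK3Sq[X, φ, P, z])
    (θ : complexBetti X 2 →ₗ[ℂ] complexBetti X 2)
    (h1 : ∀ y, IsRationalClass y → IsRationalClass (θ y))
    (h2 : ∀ (i j : ℕ) y, IsOfHodgeType 4 X 2 i j y → IsOfHodgeType 4 X 2 i j (θ y))
    (hgen : ∀ f : complexBetti X 2 →ₗ[ℂ] complexBetti X 2, (∀ y, IsRationalClass y → IsRationalClass (f y)) →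
      (∀ (i j : ℕ) y, IsOfHodgeType 4 X 2 i j y → IsOfHodgeType 4 X 2 i j (f y)) →
      (∀ e : complexBetti X 2, e ∈ algebraicClasses X 1 → f e = 0) →
      (∀ y : complexBetti X 2, ∀ e : complexBetti X 2, e ∈ algebraicClasses X 1 →
        k3HilbertForm 2 (φ (f y)) (φ e) = 0) →
      ∃ a c : ℚ, ∀ y : complexBetti X 2,
        (∀ e : complexBetti X 2, e ∈ algebraicClasses X 1 → k3HilbertForm 2 (φ y) (φ e) = 0) →
        f y = (a : ℂ) • y + (c : ℂ) • θ y) :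
    HodgeConjectureFor 4 X ↔ Kap[φ, θ] ∈ algebraicClasses X 2 :=
  ⟨fun h => h.2 2 _ (isRationalClass_kappaClass hX hM θ h1) (isOfHodgeType_kappaClass hX hM θ h2),
    fun hκ => hodgeConjectureFor_of_kappaClass_generator hV hO hX hK hM θ h1 h2 hgen hκ⟩

/-- **(KAPPA-IFF, unconditional direction) HC⁴(X) ⟹ `κ_g ∈ A²(X)` for EVERY rational type-preserving endomorphism
`g` of `H²(X)`** on a marked smooth projective fourfold — no `K3^{[2]}`-type, no named fact: `κ_g` is a rational
Hodge `(2,2)`-class. (Necessary conditions for HC⁴ on the orphan cell: every `κ_θ`, `θ ∈ E(X)`, must be algebraic.)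
[cite: VoisinHodgeI2002, §7.1.1 and §11.1] [cite: OGrady2008NumericalK3Square, §2.2] -/
theorem kappaClass_mem_algebraicClasses_of_hodgeConjectureFor (hX : IsSmoothProjective 4 X)
    (hM : MarkedK3Sq[X, φ, P, z]) (h : HodgeConjectureFor 4 X) (g : complexBetti X 2 →ₗ[ℂ] complexBetti X 2)
    (hg1 : ∀ y, IsRationalClass y → IsRationalClass (g y))
    (hg2 : ∀ (i j : ℕ) y, IsOfHodgeType 4 X 2 i j y → IsOfHodgeType 4 X 2 i j (g y)) :
    Kap[φ, g] ∈ algebraicClasses X 2 :=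
  h.2 2 _ (isRationalClass_kappaClass hX hM g hg1) (isOfHodgeType_kappaClass hX hM g hg2)

end Summit.HodgeConjecture.HodgeConjecture.Theorems.MarkmanPartnerTransport.OrphanSR

end
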